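import Literature.Computability.QuantumComplexity.ApproxMatrixProduct
import Literature.Computability.Complexity.MedianOfMeans
import HarnessLib

/-!
# Inner product estimation from sampling-and-query access (median of means)

Chia, Gilyén, Li, Lin, Tang, Wang, *Sampling-based sublinear low-rank matrix arithmetic framework
for dequantizing quantum machine learning*, J. ACM 69(5):33 (2022) = arXiv:1910.06151,
**§3.2 "Technical tools", Lemma "Inner product estimation" [Tang 2019]** (Tang, STOC 2019,
Prop. 4.2):

> Given `SQ_φ(u), Q(v) ∈ ℂⁿ`, we can output an estimate `c ∈ ℂ` such that `|c − ⟨u,v⟩| ≤ ε`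
> with probability `≥ 1 − δ` in time `O(φ‖u‖²‖v‖² (1/ε²) log(1/δ) (sq_φ(u) + q(v)))`.

and its printed proof (CGLLTW, "Deferred proofs"): sample `i` from the distribution `p` given by
`SQ_φ(u)` and set `Z := u(i)v(i)/p(i)`; then `E[Z] = ⟨u,v⟩` and `E[|Z|²] ≤ φ‖u‖²‖v‖²`; let `Z̄`
be the mean of `x := 8φ‖u‖²‖v‖²/ε²` independent copies, so that by Chebyshev
`Pr[|Z̄ − E Z̄| ≥ ε/√2] ≤ 1/4`; take the median `Z̃` of `q := 8 log(1/δ)` independent copies of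
`Z̄`; "the key observation is that if the median is far then at least half of the `Z̄`'s are
far", so by Hoeffding the failure probability is `≤ exp(−q/8) ≤ δ` (the powering lemma of
Jerrum–Valiant–Vazirani 1986, Lemma 6.1).

This file proves the **real case** (`u, v ∈ ℝⁿ`, one median instead of the component-wise one)
as a theorem about finite weighted sums, following the printed proof line by line and reusing
the tree's pieces for each step:

* the single-sample estimator and its two moments are `SampleQueryAccess.lean`
  (`OversamplingWitness.sum_lengthSqDist_mul_ipEst_scaled`, `…_sq_le`): with the `SQ_φ` witness
  `ũ` (CGLLTW Def. 2.8) the sample distribution is `p = 𝒟_ũ` and `Z = ‖ũ‖² u(i)v(i)/ũ(i)²`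
  (`= u(i)v(i)/p(i)`), here `ipEst`;
* the `x` independent copies and "the variance of the mean is `Var/x`" are the product weight
  `iidWeight` and `sum_iidWeight_mul_sq_avg_sub` of `ApproxMatrixProduct.lean`, and Chebyshev is
  its Markov step `mul_sum_filter_le_sum_mul`; this gives `ipBlockMean_far_mass_le`:
  `Pr[|Z̄ − ⟨u,v⟩| ≥ ε] ≤ φ‖u‖²‖v‖²/(x ε²)`;
* the median step (key observation + Hoeffding with the constant `exp(−q/8)`, and
  `8 ln(1/δ) ≤ q ⇒ exp(−q/8) ≤ δ`) is `Literature/Computability/Complexity/MedianOfMeans.lean`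
  (`sum_weight_median_far_le_exp`, `exp_neg_div_eight_le`), stated for ANY median selector
  `med` of the `q` block means (`IsMedian`), so no tie-breaking convention is baked in.

* the special case `u = v` is the norm-estimation half of CGLLTW's Lemma "oversampling" (§2.2):
  `‖v‖²` to multiplicative error `ν` from `x ≥ 8φ/ν²`, `q ≥ 8 ln(1/δ)` (`normSqEstimation`).

The outcome space of the whole procedure is `ω : Fin q → Fin x → Fin n` (block `i`, sample `t`)
with weight `∏_i iidWeight 𝒟_ũ (ω i) = ∏_{i,t} 𝒟_ũ(ω i t)`, and `innerProductEstimation` reads: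
if `x ≥ 8φ‖u‖²‖v‖²/ε²` and `q ≥ 8 ln(1/δ)` then the weight of the outcomes whose median is off by
`≥ ε` is `≤ δ` — i.e. `x · q = O(φ‖u‖²‖v‖² ε⁻² log(1/δ))` samples suffice, as printed.

-- TODO(general form): complex `u, v` (CGLLTW state the lemma over `ℂ`; the printed proof takes
-- the median of real and imaginary parts separately at level `ε/√2` and a union bound) — the
-- tree's `SampleQueryAccess` vocabulary is real-valued at present.
-/

noncomputable section

namespace Literature.Computability.QuantumComplexity

namespace SampleQuery

open Finset
open Literature.Computability.Complexity

variable {n : ℕ} {φ : ℝ} {u : Fin n → ℝ}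

/-- The single-sample estimator of `⟨u,v⟩` under `SQ_φ(u)` with witness `ũ`: draw `i ∼ 𝒟_ũ`,
output `Z = ‖ũ‖² u(i) v(i) / ũ(i)²` (`= u(i)v(i)/p(i)` for `p = 𝒟_ũ`).
[cite: ChiaEtAl2022, §3.2 Lemma "Inner product estimation", proof ("Deferred proofs"):
"`Z := u(i)v(i)/p(i)`"]; [cite: TangEwin2019, Proposition 4.2] -/
def ipEst (w : OversamplingWitness φ u) (v : Fin n → ℝ) (i : Fin n) : ℝ :=
  normSq w.tilde * (u i * v i / w.tilde i ^ 2)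

/-- The mean `Z̄` of one block of `x` independent samples `β : Fin x → Fin n`.
[cite: ChiaEtAl2022, §3.2 Lemma "Inner product estimation", proof: "`Z̄` the mean of
`x := 8φ‖u‖²‖v‖²/ε²` independent copies of `Z`"] -/
def ipBlockMean (w : OversamplingWitness φ u) (v : Fin n → ℝ) {x : ℕ} (β : Fin x → Fin n) : ℝ :=
  (∑ t, ipEst w v (β t)) / x

/-- `E[Z] = ⟨u,v⟩` under `𝒟_ũ` (restated from `SampleQueryAccess`).
[cite: ChiaEtAl2022, §3.2 Lemma "Inner product estimation", proof: "`E[Z] = ⟨u,v⟩`"] -/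
theorem sum_lengthSqDist_mul_ipEst_eq (w : OversamplingWitness φ u) (hu : u ≠ 0)
    (v : Fin n → ℝ) : ∑ i, lengthSqDist w.tilde i * ipEst w v i = ∑ i, u i * v i :=
  w.sum_lengthSqDist_mul_ipEst_scaled hu v

/-- `E[Z²] ≤ φ‖u‖²‖v‖²` under `𝒟_ũ` (restated from `SampleQueryAccess`).
[cite: ChiaEtAl2022, §3.2 Lemma "Inner product estimation", proof: "`E[|Z|²] ≤ φ‖u‖²‖v‖²`"] -/
theorem sum_lengthSqDist_mul_ipEst_sq_le' (w : OversamplingWitness φ u) (hu : u ≠ 0)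
    (v : Fin n → ℝ) : ∑ i, lengthSqDist w.tilde i * ipEst w v i ^ 2 ≤ φ * normSq u * normSq v :=
  w.sum_lengthSqDist_mul_ipEst_scaled_sq_le hu v

/-- **Chebyshev step.** The `𝒟_ũ^x`-mass of the blocks `β ∈ [n]^x` whose mean `Z̄` is off from
`⟨u,v⟩` by `≥ ε` is at most `φ‖u‖²‖v‖²/(x ε²)` (`Var[Z̄] = Var[Z]/x ≤ E[Z²]/x`, then Markov on
`(Z̄ − ⟨u,v⟩)²`).
[cite: ChiaEtAl2022, §3.2 Lemma "Inner product estimation", proof: "by Chebyshev's inequality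
`Pr[|Z̄ − E[Z̄]| ≥ ε/√2] ≤ 2 Var[Z]/(x ε²) ≤ 1/4`" (real case, level `ε`)] -/
theorem ipBlockMean_far_mass_le (w : OversamplingWitness φ u) (hu : u ≠ 0) (v : Fin n → ℝ)
    {x : ℕ} (hx : 0 < x) {ε : ℝ} (hε : 0 < ε) :
    ∑ β ∈ univ.filter (fun β : Fin x → Fin n => ε ≤ |ipBlockMean w v β - ∑ i, u i * v i|),
        iidWeight (lengthSqDist w.tilde) β
      ≤ φ * normSq u * normSq v / (x * ε ^ 2) := by
  classical
  set p := lengthSqDist w.tilde with hp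
  have hp0 : ∀ i, 0 ≤ p i := fun i => lengthSqDist_nonneg _ _
  have hp1 : ∑ i, p i = 1 := sum_lengthSqDist (w.tilde_ne_zero hu)
  set μ := ∑ i, u i * v i with hμ
  have hmean : ∑ i, p i * ipEst w v i = μ := sum_lengthSqDist_mul_ipEst_eq w hu v
  have hm2 : ∑ i, p i * ipEst w v i ^ 2 ≤ φ * normSq u * normSq v :=
    sum_lengthSqDist_mul_ipEst_sq_le' w hu v
  -- variance of the block mean = (Σ p (Z-μ)²)/x ≤ (Σ p Z²)/x
  have hvar : ∑ β : Fin x → Fin n, iidWeight p β * (ipBlockMean w v β - μ) ^ 2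
      ≤ φ * normSq u * normSq v / x := by
    have hx0 : x ≠ 0 := hx.ne'
    have e := sum_iidWeight_mul_sq_avg_sub hp1 (ipEst w v) hx0
    rw [sum_mul_sq_sub_mean hp1 (ipEst w v), hmean] at e
    have hdef : ∑ β : Fin x → Fin n, iidWeight p β * (ipBlockMean w v β - μ) ^ 2
        = ∑ β : Fin x → Fin n, iidWeight p β * ((∑ t, ipEst w v (β t)) / x - μ) ^ 2 := rfl
    rw [hdef, e]
    exact div_le_div_of_nonneg_right (by nlinarith [sq_nonneg μ, hm2]) (Nat.cast_nonneg _)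
  -- Markov on (Z̄ - μ)² at level ε²
  have hmk := mul_sum_filter_le_sum_mul (fun β : Fin x → Fin n => iidWeight p β)
    (fun β => (ipBlockMean w v β - μ) ^ 2) (iidWeight_nonneg hp0) (fun β => sq_nonneg _) (ε ^ 2)
  have hset : (univ.filter fun β : Fin x → Fin n => ε ≤ |ipBlockMean w v β - μ|)
      = (univ.filter fun β : Fin x → Fin n => ε ^ 2 ≤ (ipBlockMean w v β - μ) ^ 2) := by
    ext β
    simp only [Finset.mem_filter, Finset.mem_univ, true_and]
    rw [← sq_abs (ipBlockMean w v β - μ)]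
    constructor
    · intro h; exact pow_le_pow_left₀ hε.le h 2
    · intro h; nlinarith [abs_nonneg (ipBlockMean w v β - μ)]
  rw [hset]
  have hε2 : 0 < ε ^ 2 := by positivity
  rw [le_div_iff₀ (by positivity)]
  calc (∑ β ∈ univ.filter (fun β : Fin x → Fin n => ε ^ 2 ≤ (ipBlockMean w v β - μ) ^ 2),
          iidWeight p β) * (x * ε ^ 2)
      = x * (ε ^ 2 * ∑ β ∈ univ.filter (fun β : Fin x → Fin n =>
          ε ^ 2 ≤ (ipBlockMean w v β - μ) ^ 2), iidWeight p β) := by ring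
    _ ≤ x * (∑ β, iidWeight p β * (ipBlockMean w v β - μ) ^ 2) :=
        mul_le_mul_of_nonneg_left hmk (Nat.cast_nonneg _)
    _ ≤ x * (φ * normSq u * normSq v / x) := mul_le_mul_of_nonneg_left hvar (Nat.cast_nonneg _)
    _ = φ * normSq u * normSq v := by field_simp

/-- With `x ≥ 8φ‖u‖²‖v‖²/ε²` samples per block, each block mean fails (`|Z̄ − ⟨u,v⟩| ≥ ε`) with
`𝒟_ũ^x`-mass at most `1/4`.
[cite: ChiaEtAl2022, §3.2 Lemma "Inner product estimation", proof: "`… ≤ 1/4`", i.e.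
"`Pr[E_i] ≤ 1/4`"] -/
theorem ipBlockMean_far_mass_le_quarter (w : OversamplingWitness φ u) (hu : u ≠ 0)
    (v : Fin n → ℝ) {x : ℕ} (hx : 0 < x) {ε : ℝ} (hε : 0 < ε)
    (hxε : 8 * φ * normSq u * normSq v / ε ^ 2 ≤ x) :
    ∑ β ∈ univ.filter (fun β : Fin x → Fin n => ε ≤ |ipBlockMean w v β - ∑ i, u i * v i|),
        iidWeight (lengthSqDist w.tilde) β ≤ 1 / 4 := by
  refine (ipBlockMean_far_mass_le w hu v hx hε).trans ?_
  have hφuv : 0 ≤ φ * normSq u * normSq v :=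
    mul_nonneg (mul_nonneg (w.pos hu).le (normSq_nonneg _)) (normSq_nonneg _)
  have hxpos : (0 : ℝ) < x := Nat.cast_pos.2 hx
  rw [div_le_iff₀ (by positivity)]
  rw [div_le_iff₀ (by positivity)] at hxε
  nlinarith

/-- **Inner product estimation** (CGLLTW 2022 §3.2 / Tang 2019 Prop. 4.2), real case, as a
statement about the weighted outcome space of the median-of-means procedure: draw `q` blocks of
`x` i.i.d. samples from `𝒟_ũ` (`ω : Fin q → Fin x → Fin n`, weight `∏_i ∏_t 𝒟_ũ(ω i t)`), form the
block means `Z̄_i` of `Z = ‖ũ‖²u(j)v(j)/ũ(j)²` and output ANY median `med ω` of `Z̄_1,…,Z̄_q`.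
If `x ≥ 8φ‖u‖²‖v‖²/ε²` and `q ≥ 8 ln(1/δ)`, the total weight of the outcomes with
`|med ω − ⟨u,v⟩| ≥ ε` is at most `δ`; the number of samples is `x·q = O(φ‖u‖²‖v‖²ε⁻² log(1/δ))`.
[cite: ChiaEtAl2022, §3.2 Lemma "Inner product estimation" and its proof ("Deferred proofs":
Chebyshev to `1/4`, median of `8 log(1/δ)` copies, key observation, Hoeffding `exp(−q/8) ≤ δ`)];
[cite: TangEwin2019, Proposition 4.2]; [cite: JerrumValiantVazirani1986, Lemma 6.1 (powering
lemma: median of independent runs)] -/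
theorem innerProductEstimation (w : OversamplingWitness φ u) (hu : u ≠ 0) (v : Fin n → ℝ)
    {x q : ℕ} (hx : 0 < x) (hq : 0 < q) {ε δ : ℝ} (hε : 0 < ε) (hδ : 0 < δ)
    (hxε : 8 * φ * normSq u * normSq v / ε ^ 2 ≤ x) (hqδ : 8 * Real.log (1 / δ) ≤ q)
    (med : (Fin q → Fin x → Fin n) → ℝ)
    (hmed : ∀ ω, IsMedian (fun i => ipBlockMean w v (ω i)) (med ω)) :
    ∑ ω ∈ univ.filter (fun ω : Fin q → Fin x → Fin n => ε ≤ |med ω - ∑ i, u i * v i|),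
        ∏ i, iidWeight (lengthSqDist w.tilde) (ω i) ≤ δ := by
  classical
  set p := lengthSqDist w.tilde with hp
  have hp0 : ∀ i, 0 ≤ p i := fun i => lengthSqDist_nonneg _ _
  have hp1 : ∑ i, p i = 1 := sum_lengthSqDist (w.tilde_ne_zero hu)
  -- block weights: nonneg, total mass 1
  have hW0 : ∀ β : Fin x → Fin n, 0 ≤ iidWeight p β := iidWeight_nonneg hp0
  have hW1 : ∑ β : Fin x → Fin n, iidWeight p β = 1 := sum_iidWeight hp1
  -- per-block failure mass ≤ 1/4 (Chebyshev)
  have hbad := ipBlockMean_far_mass_le_quarter w hu v hx hε hxε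
  -- median of q blocks: key observation + Hoeffding, then exp(-q/8) ≤ δ
  have h := sum_weight_median_far_le_exp (fun β : Fin x → Fin n => iidWeight p β) hW0 hW1
    (fun β => ipBlockMean w v β) (∑ i, u i * v i) ε hbad hq med hmed
  exact h.trans (exp_neg_div_eight_le hδ hqδ)

/-- The same statement with an explicit median selector supplied by `exists_isMedian`: a median of
the `q` block means always exists (`q > 0`), so the procedure is well defined for every outcome.
[cite: ChiaEtAl2022, §3.2 Lemma "Inner product estimation"];
[cite: JerrumValiantVazirani1986, Lemma 6.1 ("M then outputs the median of the t results")] -/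
theorem innerProductEstimation_exists_median (w : OversamplingWitness φ u) (hu : u ≠ 0)
    (v : Fin n → ℝ) {x q : ℕ} (hx : 0 < x) (hq : 0 < q) {ε δ : ℝ} (hε : 0 < ε) (hδ : 0 < δ)
    (hxε : 8 * φ * normSq u * normSq v / ε ^ 2 ≤ x) (hqδ : 8 * Real.log (1 / δ) ≤ q) :
    ∃ med : (Fin q → Fin x → Fin n) → ℝ,
      (∀ ω, IsMedian (fun i => ipBlockMean w v (ω i)) (med ω)) ∧
      ∑ ω ∈ univ.filter (fun ω : Fin q → Fin x → Fin n => ε ≤ |med ω - ∑ i, u i * v i|),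
        ∏ i, iidWeight (lengthSqDist w.tilde) (ω i) ≤ δ := by
  classical
  have hsel : ∀ ω : Fin q → Fin x → Fin n, ∃ c, IsMedian (fun i => ipBlockMean w v (ω i)) c :=
    fun ω => by
      obtain ⟨i, hi⟩ := exists_isMedian hq (fun i => ipBlockMean w v (ω i))
      exact ⟨_, hi⟩
  choose med hmed using hsel
  exact ⟨med, hmed, innerProductEstimation w hu v hx hq hε hδ hxε hqδ med hmed⟩

/-! ### Norm estimation from `SQ_φ(v)` (CGLLTW 2022 §2.2, Lemma "oversampling", second statement)

[cite: ChiaEtAl2022, §2.2 (after Def. 2.8), Lemma: "Suppose we are given `SQ_φ(v)` and some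
`δ ∈ (0,1]`. … We can also estimate `‖v‖` to `ν` multiplicative error for `ν ∈ (0,1]` with
probability `≥ 1 − δ` in `O(ν⁻² φ sq_φ(v) log(1/δ))` time."]  This is the inner-product estimator
with `u = v`: `Z = ‖ṽ‖² v(i)²/ṽ(i)²` has mean `‖v‖²` and second moment `≤ φ‖v‖⁴`, so additive error
`ν‖v‖²` (i.e. multiplicative error `ν` on `‖v‖²`, hence at most `ν` on `‖v‖`) costs
`x · q` samples with `x ≥ 8φ/ν²`, `q ≥ 8 ln(1/δ)` — the printed `O(φ ν⁻² log(1/δ))`. -/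

/-- **Norm estimation from oversampling access** (CGLLTW 2022 §2.2 Lemma "oversampling", second
statement; Tang 2019 Prop. 4.2 with `v = u`): the median-of-means estimate built from
`Z = ‖ũ‖² u(i)²/ũ(i)²`, `i ∼ 𝒟_ũ`, with `x ≥ 8φ/ν²` samples per block and `q ≥ 8 ln(1/δ)` blocks, is
within `ν‖u‖²` of `‖u‖²` except on outcomes of total weight `≤ δ` (any median selector).
[cite: ChiaEtAl2022, §2.2 Lemma "oversampling" ("estimate `‖v‖` to `ν` multiplicative error …
in `O(ν⁻² φ … log(1/δ))` time")]; [cite: TangEwin2019, Proposition 4.2] -/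
theorem normSqEstimation (w : OversamplingWitness φ u) (hu : u ≠ 0) {x q : ℕ} (hx : 0 < x)
    (hq : 0 < q) {ν δ : ℝ} (hν : 0 < ν) (hδ : 0 < δ) (hxν : 8 * φ / ν ^ 2 ≤ x)
    (hqδ : 8 * Real.log (1 / δ) ≤ q) (med : (Fin q → Fin x → Fin n) → ℝ)
    (hmed : ∀ ω, IsMedian (fun i => ipBlockMean w u (ω i)) (med ω)) :
    ∑ ω ∈ univ.filter (fun ω : Fin q → Fin x → Fin n => ν * normSq u ≤ |med ω - normSq u|),
        ∏ i, iidWeight (lengthSqDist w.tilde) (ω i) ≤ δ := by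
  have hN : 0 < normSq u := normSq_pos hu
  have hε : 0 < ν * normSq u := mul_pos hν hN
  have hxε : 8 * φ * normSq u * normSq u / (ν * normSq u) ^ 2 ≤ x := by
    have e : 8 * φ * normSq u * normSq u / (ν * normSq u) ^ 2 = 8 * φ / ν ^ 2 := by
      field_simp
    rw [e]; exact hxν
  have h := innerProductEstimation w hu u hx hq hε hδ hxε hqδ med hmed
  have e : ∑ i, u i * u i = normSq u := by simp [normSq, sq]
  rw [e] at h
  exact h

end SampleQuery

end Literature.Computability.QuantumComplexity

end
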